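import Literature.Geometry.Kaehler.HolomorphicChainWeakLimit
import Literature.Geometry.Kaehler.HolomorphicChainAddHolds
import Literature.Geometry.Kaehler.HolomorphicChainAddProofs
import Literature.Geometry.Kaehler.LelongNumber
import HarnessLib

/-!
# The current of a holomorphic chain determines the chain

[Chirka1989, §16.1, p. 206]: "each holomorphic `p`-chain `T = Σ kᵢ Aᵢ` … determines a current
`Σ kᵢ [Aᵢ]` … In what follows we will identify this current with the chain `T`" — the
identification is legitimate because **`T ↦ [T]` is injective** (`HolomorphicChain.toCurrent_injective`):
if `[T] = 0` then the mass `‖[T]‖(B) = Σ |k_Z| 𝓗^{2p}(Z ∩ B)` of every small ball vanishes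
(`HolomorphicChain.variation_toCurrent_apply`, `setLIntegral_enorm_density_eq_sum`), whereas a
component `Z` of `T` has positive `𝓗^{2p}`-measure in every ball centred on it (its Lelong numbers
are `≥ 1`, `HasPureDim.euclideanHausdorffMeasure_image_inter_ball_pos`). Consequently the
holomorphic chain representing a current is unique
(`Current.IsHolomorphicChain.existsUnique`), e.g. the limit chain of [Chirka1989, §16.1 Prop. 1].

Also: `HolomorphicChain.toCurrent_neg`, `HolomorphicChain.toCurrent_sub`. Theorems only; no new
definitions, no named facts.

## References

* [Chirka1989] E. M. Chirka, *Complex Analytic Sets*, Kluwer 1989, §15.1 Prop. 2, p. 190; §16.1,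
  p. 206.
-/

noncomputable section

open scoped Manifold Topology ENNReal NNReal
open Set Filter MeasureTheory Metric Function TopologicalSpace

namespace Literature.Geometry.Kaehler

open Literature.Geometry.GeometricMeasureTheory

universe u

variable {V : Type u} [NormedAddCommGroup V] [InnerProductSpace ℂ V] [FiniteDimensional ℂ V]
  [MeasurableSpace V] [BorelSpace V] {Ω : Opens V} {p : ℕ}

/-! ### Analytic sets have positive volume near each of their points -/

/-- **A pure `p`-dimensional analytic set has positive `𝓗^{2p}`-measure in every ball centred at one
of its points** (its Lelong number there is `≥ 1`). [cite: Chirka1989, §15.1 Prop. 2, p. 190] -/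
theorem HasPureDim.euclideanHausdorffMeasure_image_inter_ball_pos {A : Set Ω}
    (hA : HasPureDim 𝓘(ℂ, V) A p) {a : Ω} (ha : a ∈ A) {r : ℝ} (hr : 0 < r) :
    0 < (μHE[2 * p] : Measure V) (((↑) : Ω → V) '' A ∩ ball (a : V) r) := by
  have ht := tendsto_massRatio_lelongNumber hA a.2 (p := p)
  have h1 : (0 : ℝ≥0∞) < lelongNumber A p (a : V) :=
    lt_of_lt_of_le zero_lt_one (one_le_lelongNumber hA ha)
  have hev : ∀ᶠ s in 𝓝[>] (0 : ℝ), 0 < massRatio A p (a : V) s ∧ s ∈ Ioo 0 r :=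
    (ht.eventually (lt_mem_nhds h1)).and
      (Ioo_mem_nhdsGT hr)
  obtain ⟨s, hs, hs0, hsr⟩ := hev.exists
  rw [massRatio_apply] at hs
  have hnum : (μHE[2 * p] : Measure V) (((↑) : Ω → V) '' A ∩ ball (a : V) s) ≠ 0 := by
    intro h0
    rw [h0, ENNReal.zero_div] at hs
    exact lt_irrefl _ hs
  exact (pos_iff_ne_zero.2 hnum).trans_le
    (measure_mono (inter_subset_inter_right _ (ball_subset_ball hsr.le)))

namespace HolomorphicChain

/-! ### `[-T] = -[T]`, `[T - T'] = [T] - [T']` -/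

omit [FiniteDimensional ℂ V] [MeasurableSpace V] [BorelSpace V] in
/-- `reg|-T| = reg|T|` (the chains `T` and `-T` have the same components). [cite: Chirka1989, §11.5, p. 130] -/
theorem carrier_neg (T : HolomorphicChain 𝓘(ℂ, V) Ω p) : (-T).carrier = T.carrier := by
  rw [carrier, carrier, support_neg]

omit [FiniteDimensional ℂ V] in
/-- `ξ_{-T} = ξ_T`: the canonical orientation only depends on the carrier. [cite: Chirka1989, §14.1, p. 174] -/
theorem orientationFrame_neg (T : HolomorphicChain 𝓘(ℂ, V) Ω p) :
    (-T).orientationFrame = T.orientationFrame := by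
  unfold orientationFrame
  rw [carrier_neg]

omit [FiniteDimensional ℂ V] in
/-- **`[-T] = -[T]`.** [cite: Chirka1989, §16.1, p. 206] -/
theorem toCurrent_neg (T : HolomorphicChain 𝓘(ℂ, V) Ω p) : (-T).toCurrent = -T.toCurrent := by
  rw [toCurrent_def, toCurrent_def, carrier_neg, orientationFrame_neg, density_neg,
    ← currentOfIntegration_neg]
  rfl

/-- **`[T - T'] = [T] - [T']`.** [cite: Chirka1989, §16.1, p. 206] -/
theorem toCurrent_sub (T T' : HolomorphicChain 𝓘(ℂ, V) Ω p) :
    (T - T').toCurrent = T.toCurrent - T'.toCurrent := by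
  rw [sub_eq_add_neg, Chirka1989_toCurrent_add_holds V Ω p T (-T'), toCurrent_neg, sub_eq_add_neg]

/-! ### Injectivity of `T ↦ [T]` -/

/-- **A non-zero holomorphic chain has a non-zero current**: `[T] = 0 → T = 0`.
[cite: Chirka1989, §16.1, p. 206] -/
theorem eq_zero_of_toCurrent_eq_zero {q : ℕ} (T : HolomorphicChain 𝓘(ℂ, V) Ω (q + 1))
    (h : T.toCurrent = 0) : T = 0 := by
  classical
  haveI : LocallyCompactSpace Ω := Ω.isOpen.locallyCompactSpace
  by_contra hT
  -- a component `Z` with `k = mult Z ≠ 0` and a point `a ∈ Z`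
  obtain ⟨Z, hZ⟩ : ∃ Z, T.mult Z ≠ 0 := by
    by_contra hall
    push Not at hall
    exact hT (HolomorphicChain.ext (funext fun Z => by rw [hall Z]; rfl))
  obtain ⟨a, haZ⟩ := (T.isIrreducibleAnalyticSet_of_mult_ne_zero hZ).2.1
  -- a closed ball around `a` inside `Ω`, and the finitely many components meeting it
  obtain ⟨r₀, hr₀, hB⟩ : ∃ r₀ : ℝ, 0 < r₀ ∧ closedBall (a : V) r₀ ⊆ (Ω : Set V) := by
    obtain ⟨R, hR, hRΩ⟩ := Metric.isOpen_iff.1 Ω.isOpen (a : V) a.2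
    exact ⟨R / 2, half_pos hR, (closedBall_subset_ball (half_lt_self hR)).trans hRΩ⟩
  set K : Set Ω := ((↑) : Ω → V) ⁻¹' closedBall (a : V) r₀ with hK
  have hKc : IsCompact K := by
    refine Topology.IsEmbedding.subtypeVal.isCompact_iff.2 ?_
    rw [image_preimage_eq_inter_range, Subtype.range_coe, inter_eq_left.2 hB]
    exact isCompact_closedBall _ _
  have hfin := T.finite_inter_compact hKc
  set F : Finset (Set Ω) := hfin.toFinset with hF
  have hFmem : ∀ Z' : Set Ω, T.mult Z' ≠ 0 →
      ((((↑) : Ω → V) '' Z') ∩ closedBall (a : V) r₀).Nonempty → Z' ∈ F := by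
    rintro Z' hZ' ⟨_, ⟨x, hx, rfl⟩, hxB⟩
    rw [hF, Set.Finite.mem_toFinset]
    exact ⟨hZ', x, hxB, hx⟩
  have hZF : Z ∈ F := hFmem Z hZ ⟨a, ⟨a, haZ, rfl⟩, mem_closedBall_self hr₀.le⟩
  -- the mass of `[T]` in the ball, by components
  have hsum := T.setLIntegral_enorm_density_eq_sum (le_refl r₀) F hFmem
  have hvar := T.variation_toCurrent_apply (measurableSet_ball (x := (a : V)) (ε := r₀))
  rw [h, Current.variation_zero, Measure.coe_zero, Pi.zero_apply] at hvar
  rw [← hvar] at hsum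
  -- every term vanishes, in particular the one of `Z`
  have hterm : ENNReal.ofReal |(T.mult Z : ℝ)| *
      (μHE[2 * (q + 1)] : Measure V) ((((↑) : Ω → V) '' Z) ∩ ball (a : V) r₀) = 0 := by
    have := (Finset.sum_eq_zero_iff.1 hsum.symm) Z hZF
    exact this
  rcases mul_eq_zero.1 hterm with h0 | h0
  · rw [ENNReal.ofReal_eq_zero, abs_nonpos_iff, Int.cast_eq_zero] at h0
    exact hZ h0
  · exact ((T.hasPureDim_of_mult_ne_zero hZ).euclideanHausdorffMeasure_image_inter_ball_pos haZ
      hr₀).ne' h0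

/-- **`[T] = 0 ↔ T = 0`.** [cite: Chirka1989, §16.1, p. 206] -/
theorem toCurrent_eq_zero_iff {q : ℕ} (T : HolomorphicChain 𝓘(ℂ, V) Ω (q + 1)) :
    T.toCurrent = 0 ↔ T = 0 :=
  ⟨T.eq_zero_of_toCurrent_eq_zero, fun h => by rw [h, toCurrent_zero]⟩

/-- **The current of a holomorphic chain determines the chain**: `T ↦ [T]` is injective on
holomorphic `p`-chains of positive dimension `p = q + 1` ("we will identify this current with the
chain `T`"). [cite: Chirka1989, §16.1, p. 206] -/
theorem toCurrent_injective {q : ℕ} :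
    Function.Injective (toCurrent : HolomorphicChain 𝓘(ℂ, V) Ω (q + 1) → Current Ω (2 * (q + 1))) :=
  fun T T' h => sub_eq_zero.1 ((T.toCurrent_sub T' ▸ sub_eq_zero.2 h :
    (T - T').toCurrent = 0) |> (T - T').eq_zero_of_toCurrent_eq_zero)

end HolomorphicChain

/-- **The holomorphic chain representing a current is unique**: a current that is a holomorphic
`p`-chain (`p = q + 1`) is the current of exactly one chain. [cite: Chirka1989, §16.1, p. 206] -/
theorem _root_.Literature.Geometry.GeometricMeasureTheory.Current.IsHolomorphicChain.existsUnique
    {q : ℕ} {S : Current Ω (2 * (q + 1))} (h : S.IsHolomorphicChain (q + 1)) :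
    ∃! T : HolomorphicChain 𝓘(ℂ, V) Ω (q + 1), T.toCurrent = S := by
  obtain ⟨T, hT⟩ := h
  exact ⟨T, hT, fun T' hT' => HolomorphicChain.toCurrent_injective (hT'.trans hT.symm)⟩

end Literature.Geometry.Kaehler

end
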